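import Summits.Ventures.PercRepro.SevenThreeNullityTwo

/-!
# PercRepro — the `(7,3)` cell: the series classes as a partition of the cyclic part (p3, gen 16)

The series relation `Ser` of `SevenThreeSeries.lean` is an equivalence relation on the cyclic part `K(A)` of a finset
`A`; its classes `serClass A e = {f ∈ K(A) : Ser A e f}` form the finset `serClasses A`, a partition of `K(A)`
(`biUnion_serClasses`, `pairwiseDisjoint_serClasses`, `serClass_eq_of_mem`). For a coloop-free `K` of nullity two the
sets of dual rank one are exactly the nonempty subsets of a single class, so for `j ≥ 1`
`#{C ⊆ K : |C| = j, drk K C = 1} = Σ_{N ∈ serClasses K} C(|N|, j)` (`card_filter_drk_one`) — the within-class sum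
`Σ_i C(n_i, j)` of Lemma 27.2 (`P3-C025-seven-three-plan.md` §9 (R2)).
-/

namespace PercRepro

namespace SevenThree

open Finset ThmH SixThree

variable {α : Type*} [DecidableEq α] {M : Matroid α} [M.Finite]

open scoped Classical in
/-- The series class of `e` in `A`: the non-coloops of `A` in series with `e`. -/
noncomputable def serClass (M : Matroid α) [M.Finite] (A : Finset α) (e : α) : Finset α :=
  (cyclicPart M A).filter (Ser M A e)

/-- The series classes of `A`. -/
noncomputable def serClasses (M : Matroid α) [M.Finite] (A : Finset α) : Finset (Finset α) :=
  (cyclicPart M A).image (serClass M A)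

open scoped Classical in
/-- Membership in a series class. -/
theorem mem_serClass {A : Finset α} {e f : α} : f ∈ serClass M A e ↔ f ∈ cyclicPart M A ∧ Ser M A e f := by
  unfold serClass
  rw [Finset.mem_filter]

/-- A series class is contained in the cyclic part. -/
theorem serClass_subset (A : Finset α) (e : α) : serClass M A e ⊆ cyclicPart M A := fun _ hf => (mem_serClass.1 hf).1

/-- `e ∈ serClass A e` for a non-coloop `e`. -/
theorem mem_serClass_self {A : Finset α} {e : α} (he : e ∈ cyclicPart M A) : e ∈ serClass M A e :=
  mem_serClass.2 ⟨he, ser_refl A e⟩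

/-- Two points of one series class are in series. -/
theorem ser_of_mem_serClass {A : Finset α} (hA : A ⊆ gr M) {e f g : α} (he : e ∈ cyclicPart M A)
    (hf : f ∈ serClass M A e) (hg : g ∈ serClass M A e) : Ser M A f g := by
  rw [mem_serClass] at hf hg
  exact ser_trans hA hf.1 he (ser_symm hf.2) hg.2

/-- Series points have the same class. -/
theorem serClass_eq_of_ser {A : Finset α} (hA : A ⊆ gr M) {e f : α} (he : e ∈ cyclicPart M A)
    (hf : f ∈ cyclicPart M A) (h : Ser M A e f) : serClass M A e = serClass M A f := by
  ext g
  rw [mem_serClass, mem_serClass]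
  constructor
  · rintro ⟨hg, hg'⟩
    exact ⟨hg, ser_trans hA hf he (ser_symm h) hg'⟩
  · rintro ⟨hg, hg'⟩
    exact ⟨hg, ser_trans hA he hf h hg'⟩

/-- The class of a member: `f ∈ serClass A e → serClass A f = serClass A e`. -/
theorem serClass_eq_of_mem {A : Finset α} (hA : A ⊆ gr M) {e f : α} (he : e ∈ cyclicPart M A)
    (hf : f ∈ serClass M A e) : serClass M A f = serClass M A e := by
  rw [mem_serClass] at hf
  exact (serClass_eq_of_ser hA he hf.1 hf.2).symm

/-- Two series classes are equal or disjoint. -/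
theorem serClass_eq_or_disjoint {A : Finset α} (hA : A ⊆ gr M) {e f : α} (he : e ∈ cyclicPart M A)
    (hf : f ∈ cyclicPart M A) : serClass M A e = serClass M A f ∨ Disjoint (serClass M A e) (serClass M A f) := by
  by_cases h : Disjoint (serClass M A e) (serClass M A f)
  · exact Or.inr h
  · left
    obtain ⟨g, hge, hgf⟩ := Finset.not_disjoint_iff.1 h
    rw [← serClass_eq_of_mem hA he hge, serClass_eq_of_mem hA hf hgf]

/-- Membership in `serClasses`. -/
theorem mem_serClasses {A N : Finset α} : N ∈ serClasses M A ↔ ∃ e ∈ cyclicPart M A, serClass M A e = N := by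
  unfold serClasses
  rw [Finset.mem_image]

/-- Every series class is nonempty. -/
theorem nonempty_of_mem_serClasses {A N : Finset α} (hN : N ∈ serClasses M A) : N.Nonempty := by
  obtain ⟨e, he, rfl⟩ := mem_serClasses.1 hN
  exact ⟨e, mem_serClass_self he⟩

/-- A member of a class determines it. -/
theorem eq_serClass_of_mem {A N : Finset α} (hA : A ⊆ gr M) (hN : N ∈ serClasses M A) {f : α} (hf : f ∈ N) :
    N = serClass M A f := by
  obtain ⟨e, he, rfl⟩ := mem_serClasses.1 hN
  exact (serClass_eq_of_mem hA he hf).symm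

/-- The series classes are pairwise disjoint. -/
theorem pairwiseDisjoint_serClasses {A : Finset α} (hA : A ⊆ gr M) :
    (serClasses M A : Set (Finset α)).PairwiseDisjoint id := by
  intro N hN N' hN' hne
  rw [Finset.mem_coe] at hN hN'
  obtain ⟨e, he, rfl⟩ := mem_serClasses.1 hN
  obtain ⟨f, hf, rfl⟩ := mem_serClasses.1 hN'
  rcases serClass_eq_or_disjoint hA he hf with h | h
  · exact absurd h hne
  · exact h

/-- The series classes cover the cyclic part. -/
theorem biUnion_serClasses (A : Finset α) : (serClasses M A).biUnion id = cyclicPart M A := by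
  ext e
  rw [Finset.mem_biUnion]
  constructor
  · rintro ⟨N, hN, he⟩
    obtain ⟨f, -, rfl⟩ := mem_serClasses.1 hN
    exact serClass_subset A f he
  · intro he
    exact ⟨serClass M A e, mem_serClasses.2 ⟨e, he, rfl⟩, mem_serClass_self he⟩

/-- `Σ_{N ∈ serClasses A} |N| = |K(A)|`. -/
theorem sum_card_serClasses {A : Finset α} (hA : A ⊆ gr M) :
    ∑ N ∈ serClasses M A, N.card = (cyclicPart M A).card := by
  rw [← biUnion_serClasses (M := M) A, Finset.card_biUnion (pairwiseDisjoint_serClasses hA)]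
  rfl

/-- A nonempty subset of one class has dual rank one. -/
theorem drk_eq_one_of_subset_serClass {K C N : Finset α} (hK : K ⊆ gr M)
    (hN : N ∈ serClasses M K) (hCN : C ⊆ N) (hne : C.Nonempty) : drk M K C = 1 := by
  obtain ⟨e, he, rfl⟩ := mem_serClasses.1 hN
  apply drk_eq_one_of_pairwise_ser hK (hCN.trans (serClass_subset K e)) hne
  intro f hf g hg
  exact ser_of_mem_serClass hK he (hCN hf) (hCN hg)

/-- A set of dual rank one lies in the class of any of its points. -/
theorem subset_serClass_of_drk_eq_one' {K C : Finset α} (hK : K ⊆ gr M) (hcf : cyclicPart M K = K) (hC : C ⊆ K)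
    (h : drk M K C = 1) {e : α} (he : e ∈ C) : C ⊆ serClass M K e := by
  intro f hf
  rw [mem_serClass, hcf]
  exact ⟨hC hf, subset_serClass_of_drk_eq_one hK hcf hC h he f hf⟩

open scoped Classical in
/-- **The within-class count**: for `K` coloop-free of nullity two and `j ≥ 1`,
`#{C ⊆ K : |C| = j, drk K C = 1} = Σ_{N ∈ serClasses K} C(|N|, j)`. -/
theorem card_filter_drk_one {K : Finset α} (hK : K ⊆ gr M) (hcf : cyclicPart M K = K) {j : ℕ} (hj : 1 ≤ j) :
    ((K.powersetCard j).filter (fun C => drk M K C = 1)).card = ∑ N ∈ serClasses M K, N.card.choose j := by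
  have hsplit : (K.powersetCard j).filter (fun C => drk M K C = 1) =
      (serClasses M K).biUnion (fun N => N.powersetCard j) := by
    ext C
    rw [Finset.mem_filter, Finset.mem_powersetCard, Finset.mem_biUnion]
    constructor
    · rintro ⟨⟨hCK, hCj⟩, hd⟩
      have hne : C.Nonempty := Finset.card_pos.1 (by omega)
      obtain ⟨e, he⟩ := hne
      refine ⟨serClass M K e, mem_serClasses.2 ⟨e, by rw [hcf]; exact hCK he, rfl⟩, ?_⟩
      rw [Finset.mem_powersetCard]
      exact ⟨subset_serClass_of_drk_eq_one' hK hcf hCK hd he, hCj⟩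
    · rintro ⟨N, hN, hC⟩
      rw [Finset.mem_powersetCard] at hC
      have hNK : N ⊆ K := by
        obtain ⟨e, -, rfl⟩ := mem_serClasses.1 hN
        exact (serClass_subset K e).trans (by rw [hcf])
      refine ⟨⟨hC.1.trans hNK, hC.2⟩, ?_⟩
      exact drk_eq_one_of_subset_serClass hK hN hC.1 (Finset.card_pos.1 (by omega))
  rw [hsplit, Finset.card_biUnion]
  · apply Finset.sum_congr rfl
    intro N _
    exact Finset.card_powersetCard j N
  · intro N hN N' hN' hne
    rw [Finset.mem_coe] at hN hN'
    have hdisj := pairwiseDisjoint_serClasses hK hN hN' hne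
    rw [Function.onFun, id, id] at hdisj
    rw [Function.onFun, Finset.disjoint_left]
    intro C hC hC'
    rw [Finset.mem_powersetCard] at hC hC'
    obtain ⟨e, he⟩ : C.Nonempty := Finset.card_pos.1 (by omega)
    exact Finset.disjoint_left.1 hdisj (hC.1 he) (hC'.1 he)

end SevenThree

end PercRepro
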